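import Summits.CriticalPhenomena.CardyFormulaZ2.Theses.CardySelfRefinement
import Summits.CriticalPhenomena.CardyFormulaZ2.Theorems.CardySelfRefinementLagsToInvariance
import Summits.CriticalPhenomena.CardyFormulaZ2.Theorems.CardySelfRefinementTwoLagsAllLags
import Literature.Probability.Percolation.QuadCrossingContinuityEvents
import HarnessLib

/-!
# Lag merging on a DENSE CLASS of quads already gives the crux `ScaleInvariantLimits`
# (crux stmt-CriticalPhenomena-10265, route `CardySelfRefinement`; helper `--supports`)

The landed interface `stub_scaleInvariantLimits_of_lags_two_three` asks a future lattice mechanism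
for the `o(1)`-merging, as `η → 0⁺`, of the joint crossing probabilities of critical bond-`ℤ²`
percolation at meshes `kη` and `η` (`k = 2, 3`) for EVERY finite family of quads of the plane.
This file shrinks the class of quads that has to be handled:

* `dilateLaw_eq_self_of_lags_on` — the soft identification of `S_k μ` and `μ` for ONE
  subsequential limit `μ` needs the merging hypothesis only for finite families drawn from a class
  `𝒟 ⊆ 𝒬_ℂ` inside which the common continuity quads of `μ` and `S_k μ` are dense
  (Schramm–Smirnov Thm. 1.4 (2) for that dense set, Cor. 5.2, `π`-system uniqueness);
* `dilateLaw_eq_self_of_lags_on_open_dense` — unconditionally, any OPEN DENSE class `𝒰` of quads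
  will do (the continuity quads of the finite measure `μ + S_k μ` are dense by the soft half of
  SS11 Lemma 5.1, `Quad.dense_setOf_measure_frontier_crossedEvent_eq_zero`, and a dense set meets
  every nonempty open subset of `𝒰`);
* `dilateLaw_eq_self_of_lags_on_dense_of_lemma_5_1` — modulo the named fact
  `SchrammSmirnov2011_lemma_5_1` (every crossing event is a continuity set of every subsequential
  limit; `S_k μ` is again a subsequential limit), ANY DENSE class `𝒟` will do (e.g. polygonal or
  smooth quads, once their density in `𝒬_ℂ` is available);
* `scaleInvariantLimits_of_lags_two_three_on_open_dense`,
  `scaleInvariantLimits_of_lags_two_three_on_dense_of_lemma_5_1` — with `twoLagsAllLags_proof`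
  (lags `2`, `3` ⇒ all dilations), the crux BY NAME from merging at the two lags on such a class.

References: Schramm–Smirnov 2011 (arXiv:1101.5820) Thm. 1.4 (2), Lemma 5.1, Cor. 5.2; the route
file `Theses/CardySelfRefinement.lean`; `Theorems/CardySelfRefinementLagsToInvariance.lean`
(`dilateLaw_eq_self_of_lags`, whose proof is followed here with the dense set relativised).
-/

noncomputable section

open MeasureTheory Filter Set Topology
open Literature.Probability.Percolation Literature.Probability.Percolation.QuadCrossing
open Summit.CriticalPhenomena.CardyFormulaZ2.Theses.CardySelfRefinement

namespace Summit.CriticalPhenomena.CardyFormulaZ2.Theorems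

/-- `S_k μ` is the weak limit of the laws at meshes `k δₙ` whenever `μ` is the weak limit of the
laws at meshes `δₙ` (`S_k μ_δ = μ_{kδ}` exactly, and push-forward by the homeomorphism `S_k` of
`ℋ_ℂ` is weakly continuous). -/
theorem tendsto_squareCrossingLaw_mul_of_tendsto {k : ℝ} (hk : 0 < k) {δs : ℕ → ℝ}
    {μ : FiniteMeasure (QuadConfig (univ : Set ℂ))}
    (hconv : Tendsto (fun n => squareCrossingLaw (univ : Set ℂ) (δs n)) atTop (𝓝 μ)) :
    Tendsto (fun n => squareCrossingLaw (univ : Set ℂ) (k * δs n)) atTop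
      (𝓝 (dilateLaw k hk.ne' μ)) := by
  have h := FiniteMeasure.tendsto_map_of_tendsto_of_continuous _ _ hconv
    (QuadConfig.continuous_mapHomeomorph
      (Homeomorph.mulLeft₀ (k : ℂ) (Complex.ofReal_ne_zero.mpr hk.ne')))
  have hfun : (fun n => (squareCrossingLaw (univ : Set ℂ) (δs n)).map
      (QuadConfig.mapHomeomorph
        (Homeomorph.mulLeft₀ (k : ℂ) (Complex.ofReal_ne_zero.mpr hk.ne')))) =
      fun n => squareCrossingLaw (univ : Set ℂ) (k * δs n) :=
    funext fun n => dilateLaw_squareCrossingLaw hk.ne' (δs n)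
  rw [hfun] at h
  exact h

/-- The set `Λ` of subsequential limits is `S_k`-stable: `S_k μ ∈ Λ` for `μ ∈ Λ`, `k > 0`
(along the meshes `k δₙ`). -/
theorem dilateLaw_mem_subseqQuadLimits_of_pos {k : ℝ} (hk : 0 < k)
    {μ : FiniteMeasure (QuadConfig (univ : Set ℂ))} (hμ : μ ∈ subseqQuadLimits (univ : Set ℂ)) :
    dilateLaw k hk.ne' μ ∈ subseqQuadLimits (univ : Set ℂ) := by
  obtain ⟨δs, hpos, hδ0, hconv⟩ := hμ
  exact ⟨fun n => k * δs n, fun n => mul_pos hk (hpos n), by simpa using hδ0.const_mul k,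
    tendsto_squareCrossingLaw_mul_of_tendsto hk hconv⟩

/-- **Lag merging on a class of quads rich in continuity quads merges the limits.**  Let `k > 0`,
`μ ∈ Λ`, and let `𝒟` be a class of quads such that the quads of `𝒟` whose crossing event is a
continuity set of both `μ` and `S_k μ` are dense in `𝒬_ℂ`.  If for every finite family `G` of
quads FROM `𝒟` the joint crossing probabilities of bond-`ℤ²` at meshes `kη` and `η` differ by
`o(1)` as `η → 0⁺`, then `S_k μ = μ`.  (Schramm–Smirnov: `S_k μ = lim μ_{kδₙ}` along the sequence
of `μ`; Cor. 5.2 on the joint crossing events of the dense continuity quads in `𝒟`, a `π`-system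
generating the Borel `σ`-field by Thm. 1.4 (2); `ext_of_generate_finite`.) -/
theorem dilateLaw_eq_self_of_lags_on {k : ℝ} (hk : 0 < k) {𝒟 : Set (Quad (univ : Set ℂ))}
    (hdiff : ∀ (m : ℕ) (G : Fin m → Quad (univ : Set ℂ)), (∀ i, G i ∈ 𝒟) →
      Tendsto (fun η : ℝ =>
        (squareCrossingLaw (univ : Set ℂ) (k * η) : Measure (QuadConfig (univ : Set ℂ))).real
            {S | ∀ i, G i ∈ S} -
          (squareCrossingLaw (univ : Set ℂ) η : Measure (QuadConfig (univ : Set ℂ))).real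
            {S | ∀ i, G i ∈ S}) (𝓝[>] 0) (𝓝 0))
    {μ : FiniteMeasure (QuadConfig (univ : Set ℂ))} (hμ : μ ∈ subseqQuadLimits (univ : Set ℂ))
    (hdense : Dense {Q : Quad (univ : Set ℂ) | Q ∈ 𝒟 ∧
      (μ : Measure (QuadConfig (univ : Set ℂ))) (frontier (QuadConfig.crossedEvent Q)) = 0 ∧
      ((dilateLaw k hk.ne' μ : FiniteMeasure (QuadConfig (univ : Set ℂ))) :
          Measure (QuadConfig (univ : Set ℂ))) (frontier (QuadConfig.crossedEvent Q)) = 0}) :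
    dilateLaw k hk.ne' μ = μ := by
  obtain ⟨δs, hpos, hδ0, hconv⟩ := hμ
  set ν : FiniteMeasure (QuadConfig (univ : Set ℂ)) := dilateLaw k hk.ne' μ with hν_def
  -- `ν` is the limit of the laws at meshes `k δ_n`
  have hconvν : Tendsto (fun n => squareCrossingLaw (univ : Set ℂ) (k * δs n)) atTop (𝓝 ν) :=
    tendsto_squareCrossingLaw_mul_of_tendsto hk hconv
  have hνmem : ν ∈ subseqQuadLimits (univ : Set ℂ) :=
    ⟨fun n => k * δs n, fun n => mul_pos hk (hpos n), by simpa using hδ0.const_mul k, hconvν⟩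
  haveI hμP : IsProbabilityMeasure (μ : Measure (QuadConfig (univ : Set ℂ))) :=
    isProbabilityMeasure_of_isSubseqQuadLimit isOpen_univ ⟨δs, hpos, hδ0, hconv⟩
  haveI hνP : IsProbabilityMeasure (ν : Measure (QuadConfig (univ : Set ℂ))) :=
    isProbabilityMeasure_of_isSubseqQuadLimit isOpen_univ hνmem
  -- the dense set of common continuity quads inside `𝒟`
  set A : Set (Quad (univ : Set ℂ)) := {Q : Quad (univ : Set ℂ) | Q ∈ 𝒟 ∧
      (μ : Measure (QuadConfig (univ : Set ℂ))) (frontier (QuadConfig.crossedEvent Q)) = 0 ∧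
      (ν : Measure (QuadConfig (univ : Set ℂ))) (frontier (QuadConfig.crossedEvent Q)) = 0}
    with hA
  have hAdense : Dense A := hdense
  -- the generating π-system of joint crossing events of quads of `A`
  set C : Set (Set (QuadConfig (univ : Set ℂ))) :=
    {E | ∃ (m : ℕ) (G : Fin m → Quad (univ : Set ℂ)), (∀ i, G i ∈ A) ∧ E = {S | ∀ i, G i ∈ S}}
    with hC
  have hCpi : IsPiSystem C := by
    rintro _ ⟨m, G, hG, rfl⟩ _ ⟨n, G', hG', rfl⟩ _
    refine ⟨m + n, Fin.append G G', fun i => ?_, (setOf_forall_mem_append G G').symm⟩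
    refine Fin.addCases (fun i => ?_) (fun i => ?_) i
    · simpa using hG i
    · simpa using hG' i
  have hgen : (QuadConfig.instMeasurableSpace : MeasurableSpace (QuadConfig (univ : Set ℂ))) =
      MeasurableSpace.generateFrom C := by
    have hb : (QuadConfig.instMeasurableSpace : MeasurableSpace (QuadConfig (univ : Set ℂ))) =
        borel (QuadConfig (univ : Set ℂ)) := rfl
    have h14 := QuadConfig.generateFrom_notCrossed_eq_borel_of_esb
      (fun Q => Quad.mem_closure_setOf_strictlyDominated isOpen_univ Q) hAdense
    refine le_antisymm ?_ ?_
    · rw [hb, ← h14]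
      refine MeasurableSpace.generateFrom_le ?_
      rintro _ ⟨Q, hQ, rfl⟩
      dsimp only
      rw [← QuadConfig.compl_crossedEvent]
      refine MeasurableSet.compl
        (MeasurableSpace.measurableSet_generateFrom ⟨1, fun _ => Q, ?_, ?_⟩)
      · exact fun _ => hQ
      · ext S; simp [QuadConfig.crossedEvent]
    · refine MeasurableSpace.generateFrom_le ?_
      rintro _ ⟨m, G, -, rfl⟩
      exact measurableSet_setOf_forall_mem G
  -- the two limits agree on the π-system
  have hδs : Tendsto δs atTop (𝓝[>] 0) :=
    tendsto_nhdsWithin_iff.mpr ⟨hδ0, Eventually.of_forall fun n => hpos n⟩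
  have hagree : ∀ E ∈ C, (ν : Measure (QuadConfig (univ : Set ℂ))) E =
      (μ : Measure (QuadConfig (univ : Set ℂ))) E := by
    rintro _ ⟨m, G, hG, rfl⟩
    have hE := measurableSet_generateFrom_setOf_forall_mem G
    have h1 : Tendsto (fun n => (squareCrossingLaw (univ : Set ℂ) (δs n) :
        Measure (QuadConfig (univ : Set ℂ))) {S | ∀ i, G i ∈ S}) atTop
        (𝓝 ((μ : Measure (QuadConfig (univ : Set ℂ))) {S | ∀ i, G i ∈ S})) :=
      tendsto_measure_of_null_frontier_generateFrom isOpen_univ univ_nonempty hconv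
        (finite_range G) (by rintro _ ⟨i, rfl⟩; exact (hG i).2.1) hE
    have h2 : Tendsto (fun n => (squareCrossingLaw (univ : Set ℂ) (k * δs n) :
        Measure (QuadConfig (univ : Set ℂ))) {S | ∀ i, G i ∈ S}) atTop
        (𝓝 ((ν : Measure (QuadConfig (univ : Set ℂ))) {S | ∀ i, G i ∈ S})) :=
      tendsto_measure_of_null_frontier_generateFrom isOpen_univ univ_nonempty hconvν
        (finite_range G) (by rintro _ ⟨i, rfl⟩; exact (hG i).2.2) hE
    have h1' := (ENNReal.tendsto_toReal (measure_ne_top _ _)).comp h1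
    have h2' := (ENNReal.tendsto_toReal (measure_ne_top _ _)).comp h2
    have h3 := (hdiff m G fun i => (hG i).1).comp hδs
    have h4 : Tendsto (fun n =>
        (squareCrossingLaw (univ : Set ℂ) (k * δs n) : Measure (QuadConfig (univ : Set ℂ))).real
            {S | ∀ i, G i ∈ S} -
          (squareCrossingLaw (univ : Set ℂ) (δs n) : Measure (QuadConfig (univ : Set ℂ))).real
            {S | ∀ i, G i ∈ S}) atTop
        (𝓝 (((ν : Measure (QuadConfig (univ : Set ℂ))) {S | ∀ i, G i ∈ S}).toReal -
          ((μ : Measure (QuadConfig (univ : Set ℂ))) {S | ∀ i, G i ∈ S}).toReal)) := by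
      simp only [measureReal_def]
      exact h2'.sub h1'
    have heq := tendsto_nhds_unique h4 h3
    rw [sub_eq_zero] at heq
    exact (ENNReal.toReal_eq_toReal_iff' (measure_ne_top _ _) (measure_ne_top _ _)).mp heq
  have hνμ : (ν : Measure (QuadConfig (univ : Set ℂ))) =
      (μ : Measure (QuadConfig (univ : Set ℂ))) :=
    ext_of_generate_finite C hgen hCpi hagree (by rw [measure_univ, measure_univ])
  exact FiniteMeasure.toMeasure_injective hνμ

/-- **Open dense classes suffice (unconditionally).**  Let `k > 0` and let `𝒰` be an open dense
set of quads of the plane.  If for every finite family of quads from `𝒰` the joint crossing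
probabilities of bond-`ℤ²` at meshes `kη` and `η` merge as `η → 0⁺`, then `S_k μ = μ` for every
subsequential limit `μ`: the continuity quads of the finite measure `μ + S_k μ` are dense (soft
half of SS11 Lemma 5.1, `Quad.dense_setOf_measure_frontier_crossedEvent_eq_zero`), and a dense set
meets every nonempty open subset of the open dense `𝒰` (`Dense.inter_of_isOpen_left`). -/
theorem dilateLaw_eq_self_of_lags_on_open_dense {k : ℝ} (hk : 0 < k)
    {𝒰 : Set (Quad (univ : Set ℂ))} (h𝒰o : IsOpen 𝒰) (h𝒰d : Dense 𝒰)
    (hdiff : ∀ (m : ℕ) (G : Fin m → Quad (univ : Set ℂ)), (∀ i, G i ∈ 𝒰) →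
      Tendsto (fun η : ℝ =>
        (squareCrossingLaw (univ : Set ℂ) (k * η) : Measure (QuadConfig (univ : Set ℂ))).real
            {S | ∀ i, G i ∈ S} -
          (squareCrossingLaw (univ : Set ℂ) η : Measure (QuadConfig (univ : Set ℂ))).real
            {S | ∀ i, G i ∈ S}) (𝓝[>] 0) (𝓝 0))
    {μ : FiniteMeasure (QuadConfig (univ : Set ℂ))} (hμ : μ ∈ subseqQuadLimits (univ : Set ℂ)) :
    dilateLaw k hk.ne' μ = μ := by
  refine dilateLaw_eq_self_of_lags_on hk hdiff hμ ?_
  set ν : FiniteMeasure (QuadConfig (univ : Set ℂ)) := dilateLaw k hk.ne' μ with hν_def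
  set ρ : Measure (QuadConfig (univ : Set ℂ)) :=
    (μ : Measure (QuadConfig (univ : Set ℂ))) + (ν : Measure (QuadConfig (univ : Set ℂ))) with hρ
  have hA' : Dense {Q : Quad (univ : Set ℂ) | ρ (frontier (QuadConfig.crossedEvent Q)) = 0} :=
    Quad.dense_setOf_measure_frontier_crossedEvent_eq_zero isOpen_univ ρ
  have hsub : 𝒰 ∩ {Q : Quad (univ : Set ℂ) | ρ (frontier (QuadConfig.crossedEvent Q)) = 0} ⊆
      {Q : Quad (univ : Set ℂ) | Q ∈ 𝒰 ∧
        (μ : Measure (QuadConfig (univ : Set ℂ))) (frontier (QuadConfig.crossedEvent Q)) = 0 ∧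
        (ν : Measure (QuadConfig (univ : Set ℂ))) (frontier (QuadConfig.crossedEvent Q)) = 0} := by
    rintro Q ⟨hQ𝒰, hQ⟩
    have hQ' : ρ (frontier (QuadConfig.crossedEvent Q)) = 0 := hQ
    rw [hρ, Measure.add_apply, add_eq_zero] at hQ'
    exact ⟨hQ𝒰, hQ'.1, hQ'.2⟩
  exact (h𝒰d.inter_of_isOpen_left hA' h𝒰o).mono hsub

/-- **Any dense class suffices, modulo Schramm–Smirnov's Lemma 5.1.**  Let `k > 0`, let `𝒟` be a
dense set of quads of the plane, and assume the named fact `SchrammSmirnov2011_lemma_5_1` (every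
crossing event `⊞_Q` is a continuity set of every subsequential limit).  If for every finite family
of quads from `𝒟` the joint crossing probabilities at meshes `kη` and `η` merge as `η → 0⁺`, then
`S_k μ = μ` for every subsequential limit `μ` (`S_k μ` is itself a subsequential limit,
`dilateLaw_mem_subseqQuadLimits_of_pos`, so every quad of `𝒟` is a common continuity quad). -/
theorem dilateLaw_eq_self_of_lags_on_dense_of_lemma_5_1 (h51 : SchrammSmirnov2011_lemma_5_1)
    {k : ℝ} (hk : 0 < k) {𝒟 : Set (Quad (univ : Set ℂ))} (h𝒟 : Dense 𝒟)
    (hdiff : ∀ (m : ℕ) (G : Fin m → Quad (univ : Set ℂ)), (∀ i, G i ∈ 𝒟) →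
      Tendsto (fun η : ℝ =>
        (squareCrossingLaw (univ : Set ℂ) (k * η) : Measure (QuadConfig (univ : Set ℂ))).real
            {S | ∀ i, G i ∈ S} -
          (squareCrossingLaw (univ : Set ℂ) η : Measure (QuadConfig (univ : Set ℂ))).real
            {S | ∀ i, G i ∈ S}) (𝓝[>] 0) (𝓝 0))
    {μ : FiniteMeasure (QuadConfig (univ : Set ℂ))} (hμ : μ ∈ subseqQuadLimits (univ : Set ℂ)) :
    dilateLaw k hk.ne' μ = μ := by
  refine dilateLaw_eq_self_of_lags_on hk hdiff hμ (h𝒟.mono fun Q hQ => ⟨hQ, ?_, ?_⟩)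
  · exact h51 univ isOpen_univ univ_nonempty μ hμ Q
  · exact h51 univ isOpen_univ univ_nonempty _ (dilateLaw_mem_subseqQuadLimits_of_pos hk hμ) Q

/-- **The crux from merging at lags `2`, `3` on an open dense class of quads.**  If for every
finite family of quads from an open dense set `𝒰 ⊆ 𝒬_ℂ` the joint crossing probabilities of
critical bond-`ℤ²` percolation at meshes `2η`, `η` and at meshes `3η`, `η` merge as `η → 0⁺`, then
`ScaleInvariantLimits` holds (`dilateLaw_eq_self_of_lags_on_open_dense` at `k = 2, 3`, then
`twoLagsAllLags_proof`). -/
theorem scaleInvariantLimits_of_lags_two_three_on_open_dense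
    {𝒰 : Set (Quad (univ : Set ℂ))} (h𝒰o : IsOpen 𝒰) (h𝒰d : Dense 𝒰)
    (h2 : ∀ (m : ℕ) (G : Fin m → Quad (univ : Set ℂ)), (∀ i, G i ∈ 𝒰) →
      Tendsto (fun η : ℝ =>
        (squareCrossingLaw (univ : Set ℂ) (2 * η) : Measure (QuadConfig (univ : Set ℂ))).real
            {S | ∀ i, G i ∈ S} -
          (squareCrossingLaw (univ : Set ℂ) η : Measure (QuadConfig (univ : Set ℂ))).real
            {S | ∀ i, G i ∈ S}) (𝓝[>] 0) (𝓝 0))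
    (h3 : ∀ (m : ℕ) (G : Fin m → Quad (univ : Set ℂ)), (∀ i, G i ∈ 𝒰) →
      Tendsto (fun η : ℝ =>
        (squareCrossingLaw (univ : Set ℂ) (3 * η) : Measure (QuadConfig (univ : Set ℂ))).real
            {S | ∀ i, G i ∈ S} -
          (squareCrossingLaw (univ : Set ℂ) η : Measure (QuadConfig (univ : Set ℂ))).real
            {S | ∀ i, G i ∈ S}) (𝓝[>] 0) (𝓝 0)) :
    ScaleInvariantLimits :=
  twoLagsAllLags_proof fun _ hν =>
    ⟨dilateLaw_eq_self_of_lags_on_open_dense two_pos h𝒰o h𝒰d h2 hν,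
      dilateLaw_eq_self_of_lags_on_open_dense three_pos h𝒰o h𝒰d h3 hν⟩

/-- **The crux from merging at lags `2`, `3` on any dense class of quads, modulo Lemma 5.1.**
Assuming `SchrammSmirnov2011_lemma_5_1`, if for every finite family of quads from a dense set
`𝒟 ⊆ 𝒬_ℂ` the joint crossing probabilities at meshes `2η`, `η` and `3η`, `η` merge as `η → 0⁺`,
then `ScaleInvariantLimits` holds. -/
theorem scaleInvariantLimits_of_lags_two_three_on_dense_of_lemma_5_1
    (h51 : SchrammSmirnov2011_lemma_5_1) {𝒟 : Set (Quad (univ : Set ℂ))} (h𝒟 : Dense 𝒟)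
    (h2 : ∀ (m : ℕ) (G : Fin m → Quad (univ : Set ℂ)), (∀ i, G i ∈ 𝒟) →
      Tendsto (fun η : ℝ =>
        (squareCrossingLaw (univ : Set ℂ) (2 * η) : Measure (QuadConfig (univ : Set ℂ))).real
            {S | ∀ i, G i ∈ S} -
          (squareCrossingLaw (univ : Set ℂ) η : Measure (QuadConfig (univ : Set ℂ))).real
            {S | ∀ i, G i ∈ S}) (𝓝[>] 0) (𝓝 0))
    (h3 : ∀ (m : ℕ) (G : Fin m → Quad (univ : Set ℂ)), (∀ i, G i ∈ 𝒟) →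
      Tendsto (fun η : ℝ =>
        (squareCrossingLaw (univ : Set ℂ) (3 * η) : Measure (QuadConfig (univ : Set ℂ))).real
            {S | ∀ i, G i ∈ S} -
          (squareCrossingLaw (univ : Set ℂ) η : Measure (QuadConfig (univ : Set ℂ))).real
            {S | ∀ i, G i ∈ S}) (𝓝[>] 0) (𝓝 0)) :
    ScaleInvariantLimits :=
  twoLagsAllLags_proof fun _ hν =>
    ⟨dilateLaw_eq_self_of_lags_on_dense_of_lemma_5_1 h51 two_pos h𝒟 h2 hν,
      dilateLaw_eq_self_of_lags_on_dense_of_lemma_5_1 h51 three_pos h𝒟 h3 hν⟩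

end Summit.CriticalPhenomena.CardyFormulaZ2.Theorems

end
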